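import Summits.AnomalousDissipation.AnomalousDissipation.Theorems.SolenoidalFractalHomogenisationLagrangianStepSidebandOwnSlotFeedback
import HarnessLib

/-!
# K1L_D `stub_D1_exactFamily` clause (i) (`stub_D1_residueTail`, registry v17) — brick A1(c)-III(b2): SLOT-TIME SUBSTITUTION for the own-slot kernel
# (`t = startⱼ + L u`, `L = τⱼ¹` the slot length: the envelope becomes the unit trapezoid, the kernel `exp((t−s)·B)` becomes `exp((u−x)·(L·B))`)
# (helper; `--supports stmt-AnomalousDissipation-27980`)

Summits-side helper file of route `SolenoidalFractalHomogenisation` (prover seat `ad-sawtooth-k1loc-p1` g12; variant A of D26-6/D26-7; identification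
`diag psiStar = excQS`, `κ = 1`).  Everything proved; no definitions, no named facts, no sorry.  Pure calculus, generic in a complete normed space `E`:
* `trapezoid_affine` — `trapezoid t₀ L ρ (t₀ + L u) = trapezoid 0 1 ρ u` (`L > 0`);
* `integral_slot_subst` — `∫_{t₀}^{t₀+Lu} f = L • ∫₀ᵘ f(t₀ + Lx) dx`;
* **`double_integral_slot_subst`** — for any `K : ℝ → E` (the kernel as a function of the time lag) continuous:
  `∫_{t₀}^{t₀+L} trap(t) • ∫_{t₀}^{t} trap(s) • K(t − s) ds dt = L • L • ∫₀¹ a(u) • ∫₀ᵘ a(x) • K(L(u − x)) dx du`, `a = trapezoid 0 1 ρ`, `trap = trapezoid t₀ L ρ`.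
Applied (next brick) with `K(σ) = exp(σ • Bⱼ↾ℝ)(P v)`, `L = MBτⱼ/ν`, and `…SidebandBlockExp.exp_blockGen_transversalProj` (`L·4π²ν|mⱼ|² = Tⱼ`), this turns the
main term of `…SidebandOwnSlotFeedback.feedback_response_eq_of_mem_slot`, integrated over the slot (`…SidebandMeanSlot.meanFeedback_eq_slot_integral`), into
`L²·(8π²|αⱼ|²/P)·(1/Tⱼ)·(qsResp ρ Tⱼ (regBlock S m̂ⱼ) * projPerp m̂ⱼ)` read on `ℂ³`, i.e. `(ν/4π²) M_{jj} = slotCoefⱼ · slotQⱼ + wrap`.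
NOT a proof of any registered stub, of the crux, or of anomalous dissipation; rung leaf F-D1 infrastructure.
-/

set_option linter.dupNamespace false

noncomputable section

namespace Summit.AnomalousDissipation.AnomalousDissipation.Theorems.SolenoidalFractalHomogenisation.LagrangianStep.Sideband

open Set MeasureTheory intervalIntegral
open Literature.Analysis Literature.Analysis.FunctionSpaces Literature.Analysis.FunctionSpaces.Torus
open Literature.Analysis.FluidPDE Literature.Analysis.FluidPDE.Torus Literature.Analysis.FluidPDE.LatticeShear

/-! ## §1 The envelope in slot time -/

/-- **The slot envelope in slot time is the unit trapezoid**: `trapezoid t₀ L ρ (t₀ + L u) = trapezoid 0 1 ρ u` for `L > 0`. [folklore] -/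
theorem trapezoid_affine {L : ℝ} (hL : 0 < L) (t₀ ρ u : ℝ) :
    LatticeWord.trapezoid t₀ L ρ (t₀ + L * u) = LatticeWord.trapezoid 0 1 ρ u := by
  unfold LatticeWord.trapezoid
  have e1 : (t₀ + L * u - t₀) / (ρ * L) = (u - 0) / (ρ * 1) := by
    rw [mul_one, sub_zero, show t₀ + L * u - t₀ = u * L by ring, mul_div_mul_right _ _ hL.ne']
  have e2 : (t₀ + L - (t₀ + L * u)) / (ρ * L) = (0 + 1 - u) / (ρ * 1) := by
    rw [mul_one, zero_add, show t₀ + L - (t₀ + L * u) = (1 - u) * L by ring, mul_div_mul_right _ _ hL.ne']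
  rw [e1, e2]

/-! ## §2 Affine substitution of the slot -/

variable {E : Type*} [NormedAddCommGroup E] [NormedSpace ℝ E]

/-- `∫_{t₀}^{t₀ + L u} f = L • ∫₀ᵘ f (t₀ + L x) dx`. [folklore] -/
theorem integral_slot_subst (f : ℝ → E) (t₀ L u : ℝ) :
    ∫ s in t₀..t₀ + L * u, f s = L • ∫ x in (0:ℝ)..u, f (t₀ + L * x) := by
  have h := intervalIntegral.smul_integral_comp_mul_add (a := (0:ℝ)) (b := u) f L t₀
  simp only [mul_zero, zero_add] at h
  rw [show t₀ + L * u = L * u + t₀ from add_comm _ _, ← h]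
  congr 1
  refine intervalIntegral.integral_congr fun x _ => ?_
  rw [add_comm]

/-- **Double slot-time substitution** for a lag kernel `K`:
`∫_{t₀}^{t₀+L} trap(t) • ∫_{t₀}^{t} trap(s) • K(t − s) ds dt = L • L • ∫₀¹ a(u) • ∫₀ᵘ a(x) • K(L(u − x)) dx du`. [folklore] -/
theorem double_integral_slot_subst {L : ℝ} (hL : 0 < L) (t₀ ρ : ℝ) (K : ℝ → E) :
    ∫ t in t₀..t₀ + L, LatticeWord.trapezoid t₀ L ρ t • ∫ s in t₀..t, LatticeWord.trapezoid t₀ L ρ s • K (t - s) =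
      L • L • ∫ u in (0:ℝ)..1, LatticeWord.trapezoid 0 1 ρ u • ∫ x in (0:ℝ)..u, LatticeWord.trapezoid 0 1 ρ x • K (L * (u - x)) := by
  -- outer substitution `t = t₀ + L u`
  have hout := integral_slot_subst (fun t => LatticeWord.trapezoid t₀ L ρ t • ∫ s in t₀..t, LatticeWord.trapezoid t₀ L ρ s • K (t - s)) t₀ L 1
  rw [mul_one] at hout
  rw [hout]
  congr 1
  -- pointwise in `u`: inner substitution `s = t₀ + L x` and the envelope in slot time
  rw [← intervalIntegral.integral_smul]
  refine intervalIntegral.integral_congr fun u _ => ?_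
  rw [trapezoid_affine hL, integral_slot_subst (fun s => LatticeWord.trapezoid t₀ L ρ s • K (t₀ + L * u - s)) t₀ L u, smul_comm]
  congr 1
  congr 1
  refine intervalIntegral.integral_congr fun x _ => ?_
  rw [trapezoid_affine hL]
  congr 1
  congr 1
  ring

end Summit.AnomalousDissipation.AnomalousDissipation.Theorems.SolenoidalFractalHomogenisation.LagrangianStep.Sideband
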